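import Literature.AlgebraicGeometry.AbelianSchemes.AbelianSchemeHomReductionValuationModel
import Literature.AlgebraicGeometry.AbelianSchemes.ClosedSubschemeFactorisationOfGeneric
import HarnessLib

/-!
# FACTORISATION THROUGH A CLOSED SUB-OBJECT OF THE TARGET MODEL TRANSFERS FROM THE GENERIC TO THE SPECIAL FIBRE OF A REDUCED HOMOMORPHISM
# (the image-side twin of ★ (ν8R) `pullback_map_comp_specialFibre_eq_one_of_generic`; [SerreTate1968] §1 Lemma 2, [BoschLutkebohmertRaynaud1990] §7.1, [EGAIV3] 11.10.5)

Topic `AlgebraicGeometry/AbelianSchemes`, namespace `Literature.AlgebraicGeometry.AbelianSchemes.AbelianSchemeOver`.  THEOREMS ONLY (no definition, no named fact, no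
instance, no notation, no `sorry`).  Cell `hodgecm-mathlib` (D-0151), F0∕P6 «MOD» (crux hLiu418 = stmt-HodgeConjecture-24832, `--supports`, count-neutral), half-A line L2,
organ **(IMG) «image line engine»** (LA2-plan (g2) deal∕ruling 2026-09-02T08:41Z∕08:56Z to A-p06 (g36)), layer (b) of the transfer row **(v-c) FACTORISATION**: in the
abstract two-stage setting of ★ (ν8R) `AbelianSchemeHomReductionValuationModel` (stage `V′ → V → T`, stage homomorphism `U`, `R`-model bases `x_R = (r ≫ g) ≫ z` for `𝒜`
AND `x_R″ = (r ≫ g) ≫ z″` for `𝒞`, generic∕special points `η_r`, `s_r`), for a FLAT `incl : 𝒦 → 𝒜_{x_R}` and a CLOSED `ζ : 𝒵 ↪ 𝒞_{x_R″}` over `V_r`: if `𝒦_{η_r}`, read in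
`(𝒜|_U)_y` through the three-piece isomorphism, is mapped by `u` INTO `𝒵_{η_r}` read in `(𝒞|_U)_{y″}` through ITS three-piece isomorphism, then `𝒦_{s_r}` is mapped by
`ū := E_𝒜 ≫ U_{b′} ≫ E_𝒞⁻¹` into `𝒵_{s_r}`, both read through the special three-piece isomorphisms.  HONEST LABEL: HC_CM is proved only modulo the cell's 2 remaining
named inputs (hLiu418 24832, h413 24833) until rung 0 closes; generic capital, pays no letter.

ROAD.  Transport `U_{V_r}` to a homomorphism of the `R`-MODELS `Φ := τ_𝒜 ≫ U_{V_r} ≫ σ_𝒞 : 𝒜_{x_R} → 𝒞_{x_R″}` (`τ`, `σ` the transitivity isomorphisms ★ `baseChangeCompGrpIso`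
and their inverses); by §1 coherence (★ (ν8R-coh) `fibreHom_comp_five_inv_eq_three_inv`, for `𝒜` at `z` and for `𝒞` at `z″`) its fibre at `η_r` is `three_𝒜⁻¹ ≫ u ≫ three_𝒞`
and its fibre at `s_r` is `three_𝒜⁻¹ ≫ ū ≫ three_𝒞`; so the hypothesis says `(incl ≫ Φ)_{η_r}` factors through `ζ_{η_r}`, ★ (a) `exists_comp_eq_of_pullback_map`
(`ClosedSubschemeFactorisationOfGeneric`: `𝒦` flat, `η_r` schematically dominant, `ζ` closed) gives `incl ≫ Φ = M ≫ ζ` over `V_r`, and base change to `s_r` concludes.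

* §2 HEAD **`pullback_map_exists_comp_specialFibre_of_generic`** (the fibres of `σ_𝒞` at `η_r`∕`s_r` are computed inside the proof from the coherence, as inverses).

## References
* [SerreTate1968] J.-P. Serre, J. Tate, *Good reduction of abelian varieties*, Ann. of Math. 88 (1968), §1 Lemma 2.
* [BoschLutkebohmertRaynaud1990] S. Bosch, W. Lütkebohmert, M. Raynaud, *Néron Models* (1990), §2.5 Prop. 2 (p. 56), §7.1 (pp. 172–175).
* [EGAIV3] A. Grothendieck, J. Dieudonné, EGA IV₃ (1966), 11.10.5.
* [GortzWedhorn2020] U. Görtz, T. Wedhorn, *Algebraic Geometry I*, 2nd ed. (2020), Prop. 9.19, Rem. 9.20 (pp. 236–237); Definition 4.45 (2) (p. 117).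
-/

set_option autoImplicit false

noncomputable section

set_option backward.isDefEq.respectTransparency false

universe u

open CategoryTheory CategoryTheory.Limits AlgebraicGeometry MonoidalCategory CartesianMonoidalCategory
open scoped MonObj CategoryTheory.Obj
open Literature.AlgebraicGeometry.Motives

namespace Literature.AlgebraicGeometry.AbelianSchemes

namespace AbelianSchemeOver

section Model

/-- `e.hom ≫ e.inv = 𝟙` on the underlying objects, for an isomorphism of group objects. [folklore] -/
private theorem grpIso_hom_hom_comp_inv' {C : Type*} [Category C] [CartesianMonoidalCategory C] {G H : Grp C} (e : G ≅ H) :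
    e.hom.hom.hom ≫ e.inv.hom.hom = 𝟙 G.X := by
  change (e.hom ≫ e.inv).hom.hom = _
  rw [Iso.hom_inv_id]
  rfl

/-- `e.inv ≫ e.hom = 𝟙` on the underlying objects, for an isomorphism of group objects. [folklore] -/
private theorem grpIso_inv_hom_comp_hom' {C : Type*} [Category C] [CartesianMonoidalCategory C] {G H : Grp C} (e : G ≅ H) :
    e.inv.hom.hom ≫ e.hom.hom.hom = 𝟙 H.X := by
  change (e.inv ≫ e.hom).hom.hom = _
  rw [Iso.inv_hom_id]
  rfl

/-- `E⁻¹ ≫ E = 𝟙` on the underlying group-scheme morphisms, for an isomorphism of abelian varieties. [folklore] -/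
private theorem avIso_inv_comp_hom {k : Type u} [Field k] {X Y : AbelianVariety k} (E : X ≅ Y) :
    E.inv.hom.hom.hom ≫ E.hom.hom.hom.hom = 𝟙 _ :=
  AbelianVariety.iso_hom_hom_hom_hom_comp_inv E.symm

variable {T Ug V V' Us Vr : Scheme.{u}} {Ω κ : Type u} [Field Ω] [Field κ]
  (j : Ug ⟶ T) (z z'' : V ⟶ T) (g : V' ⟶ V) (y y'' : Spec (.of Ω) ⟶ Ug) (a : Spec (.of Ω) ⟶ V) (a' : Spec (.of Ω) ⟶ V')
  (hpt : y ≫ j = a ≫ z) (hpt'' : y'' ≫ j = a ≫ z'') (e : a' ≫ g = a)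
  (js : Us ⟶ T) (ys ys'' : Spec (.of κ) ⟶ Us) (b : Spec (.of κ) ⟶ V) (b' : Spec (.of κ) ⟶ V')
  (hspt : ys ≫ js = b ≫ z) (hspt'' : ys'' ≫ js = b ≫ z'') (es : b' ≫ g = b)
  (𝒜 𝒞 : AbelianSchemeOver T)
  (U : ((𝒜.baseChange z).baseChange g).X ⟶ ((𝒞.baseChange z'').baseChange g).X) [IsMonHom U]
  (u : ((𝒜.baseChange j).baseChange y).X ⟶ ((𝒞.baseChange j).baseChange y'').X) [IsMonHom u]
  (hfib : fibreHom U a' =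
    (𝒜.fibreBaseChangeIso j y ≪≫ 𝒜.fibreCongrPtIso hpt ≪≫ (𝒜.fibreBaseChangeIso z a).symm ≪≫ ((𝒜.baseChange z).fibreCongrPtIso e).symm ≪≫ ((𝒜.baseChange z).fibreBaseChangeIso g a').symm).inv ≫ homOfIsMonHom u ≫
      (𝒞.fibreBaseChangeIso j y'' ≪≫ 𝒞.fibreCongrPtIso hpt'' ≪≫ (𝒞.fibreBaseChangeIso z'' a).symm ≪≫ ((𝒞.baseChange z'').fibreCongrPtIso e).symm ≪≫ ((𝒞.baseChange z'').fibreBaseChangeIso g a').symm).hom)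
  (r : Vr ⟶ V') (xR xR'' : Vr ⟶ T) (hxR : xR = (r ≫ g) ≫ z) (hxR'' : xR'' = (r ≫ g) ≫ z'') (ηr : Spec (.of Ω) ⟶ Vr) (sr : Spec (.of κ) ⟶ Vr)
  (hηr : ηr ≫ r = a') (hsr : sr ≫ r = b') [QuasiCompact ηr] [IsSchemeTheoreticallyDominant ηr]
  (hpr : y ≫ j = ηr ≫ xR) (hps : ys ≫ js = sr ≫ xR) (hpr'' : y'' ≫ j = ηr ≫ xR'') (hps'' : ys'' ≫ js = sr ≫ xR'')

/-! ### §2 The factorisation transfer -/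

include hfib hxR hxR'' hηr hsr in
set_option maxHeartbeats 800000 in
/-- **FACTORISATION TRANSFERS ALONG A FLAT `𝒦 ↪ 𝒜_{x_R}` INTO A CLOSED `𝒵 ↪ 𝒞_{x_R″}`.**  In the abstract two-stage setting of ★ (ν8R), let both `R`-model bases factor through the
stage, `x_R = (r ≫ g) ≫ z`, `x_R″ = (r ≫ g) ≫ z″`, with points `η_r`, `s_r` of `V_r` over `a′`, `b′` (`η_r` quasi-compact schematically dominant), `incl : 𝒦 → 𝒜_{x_R}` with
`𝒦 → V_r` FLAT, `ζ : 𝒵 → 𝒞_{x_R″}` a CLOSED IMMERSION.  If `𝒦_{η_r}` (read in `(𝒜|_U)_y` through the three-piece isomorphism) is carried by `u` into `𝒵_{η_r}` (read in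
`(𝒞|_U)_{y″}` through the three-piece isomorphism) — i.e. `incl_{η_r} ≫ three_𝒜⁻¹ ≫ u` factors through `ζ_{η_r} ≫ three_𝒞⁻¹` — then `incl_{s_r} ≫ three_𝒜⁻¹ ≫ ū` factors through
`ζ_{s_r} ≫ three_𝒞⁻¹`, `ū := E_𝒜 ≫ U_{b′} ≫ E_𝒞⁻¹` (§1 coherence + ★ `exists_comp_eq_of_pullback_map` over `V_r`). [cite: BoschLutkebohmertRaynaud1990, §7.1 (pp. 172–175)]
[cite: SerreTate1968, §1 Lemma 2] [cite: EGAIV3, 11.10.5] [cite: GortzWedhorn2020, Prop. 9.19 and Rem. 9.20 (pp. 236–237)] -/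
theorem pullback_map_exists_comp_specialFibre_of_generic (𝒦 : Over Vr) (incl : 𝒦 ⟶ (𝒜.baseChange xR).X) [Flat 𝒦.hom]
    (𝒵 : Over Vr) (ζ : 𝒵 ⟶ (𝒞.baseChange xR'').X) [IsClosedImmersion ζ.left]
    (hfac : ∃ m : (Over.pullback ηr).obj 𝒦 ⟶ (Over.pullback ηr).obj 𝒵,
      m ≫ ((Over.pullback ηr).map ζ ≫ (𝒞.fibreBaseChangeIso j y'' ≪≫ 𝒞.fibreCongrPtIso hpr'' ≪≫ (𝒞.fibreBaseChangeIso xR'' ηr).symm).inv.hom.hom.hom) =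
        ((Over.pullback ηr).map incl ≫ (𝒜.fibreBaseChangeIso j y ≪≫ 𝒜.fibreCongrPtIso hpr ≪≫ (𝒜.fibreBaseChangeIso xR ηr).symm).inv.hom.hom.hom) ≫ u) :
    ∃ m : (Over.pullback sr).obj 𝒦 ⟶ (Over.pullback sr).obj 𝒵,
      m ≫ ((Over.pullback sr).map ζ ≫ (𝒞.fibreBaseChangeIso js ys'' ≪≫ 𝒞.fibreCongrPtIso hps'' ≪≫ (𝒞.fibreBaseChangeIso xR'' sr).symm).inv.hom.hom.hom) =
        ((Over.pullback sr).map incl ≫ (𝒜.fibreBaseChangeIso js ys ≪≫ 𝒜.fibreCongrPtIso hps ≪≫ (𝒜.fibreBaseChangeIso xR sr).symm).inv.hom.hom.hom) ≫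
          ((𝒜.fibreBaseChangeIso js ys ≪≫ 𝒜.fibreCongrPtIso hspt ≪≫ (𝒜.fibreBaseChangeIso z b).symm ≪≫ ((𝒜.baseChange z).fibreCongrPtIso es).symm ≪≫ ((𝒜.baseChange z).fibreBaseChangeIso g b').symm).hom ≫ fibreHom U b' ≫ (𝒞.fibreBaseChangeIso js ys'' ≪≫ 𝒞.fibreCongrPtIso hspt'' ≪≫ (𝒞.fibreBaseChangeIso z'' b).symm ≪≫ ((𝒞.baseChange z'').fibreCongrPtIso es).symm ≪≫ ((𝒞.baseChange z'').fibreBaseChangeIso g b').symm).inv).hom.hom.hom := by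
  subst hxR hxR'' hηr hsr
  haveI := isMonHom_baseChangeHom U r
  -- the transitivity isomorphisms `τ_𝒜 : 𝒜_{x_R} ⟶ ((𝒜_z)_{V′})_{V_r}`, `τ_𝒞`, `σ_𝒞 = τ_𝒞⁻¹`
  have c1 : ((𝒞.baseChange z'').baseChangeCompGrpIso g r).hom.hom.hom ≫ ((𝒞.baseChange z'').baseChangeCompGrpIso g r).inv.hom.hom = 𝟙 _ :=
    grpIso_hom_hom_comp_inv' ((𝒞.baseChange z'').baseChangeCompGrpIso g r)
  have c2 : (𝒞.baseChangeCompGrpIso z'' (r ≫ g)).hom.hom.hom ≫ (𝒞.baseChangeCompGrpIso z'' (r ≫ g)).inv.hom.hom = 𝟙 _ :=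
    grpIso_hom_hom_comp_inv' (𝒞.baseChangeCompGrpIso z'' (r ≫ g))
  have c3 : (𝒞.baseChangeCompGrpIso z'' (r ≫ g)).inv.hom.hom ≫ (𝒞.baseChangeCompGrpIso z'' (r ≫ g)).hom.hom.hom = 𝟙 _ :=
    grpIso_inv_hom_comp_hom' (𝒞.baseChangeCompGrpIso z'' (r ≫ g))
  have c4 : ((𝒞.baseChange z'').baseChangeCompGrpIso g r).inv.hom.hom ≫ ((𝒞.baseChange z'').baseChangeCompGrpIso g r).hom.hom.hom = 𝟙 _ :=
    grpIso_inv_hom_comp_hom' ((𝒞.baseChange z'').baseChangeCompGrpIso g r)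
  have hτσ : ((𝒞.baseChangeCompGrpIso z'' (r ≫ g)).hom.hom.hom ≫ ((𝒞.baseChange z'').baseChangeCompGrpIso g r).hom.hom.hom) ≫
      (((𝒞.baseChange z'').baseChangeCompGrpIso g r).inv.hom.hom ≫ (𝒞.baseChangeCompGrpIso z'' (r ≫ g)).inv.hom.hom) = 𝟙 _ := by
    simp only [Category.assoc, reassoc_of% c1, c2]
  have hστ : (((𝒞.baseChange z'').baseChangeCompGrpIso g r).inv.hom.hom ≫ (𝒞.baseChangeCompGrpIso z'' (r ≫ g)).inv.hom.hom) ≫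
      ((𝒞.baseChangeCompGrpIso z'' (r ≫ g)).hom.hom.hom ≫ ((𝒞.baseChange z'').baseChangeCompGrpIso g r).hom.hom.hom) = 𝟙 _ := by
    simp only [Category.assoc, reassoc_of% c3, c4]
  -- the model homomorphism `Φ := τ_𝒜 ≫ U_{V_r} ≫ σ_𝒞 : 𝒜_{x_R} ⟶ 𝒞_{x_R″}` over `V_r`
  set Φ : (𝒜.baseChange ((r ≫ g) ≫ z)).X ⟶ (𝒞.baseChange ((r ≫ g) ≫ z'')).X :=
    (((𝒜.baseChangeCompGrpIso z (r ≫ g)).hom.hom.hom ≫ ((𝒜.baseChange z).baseChangeCompGrpIso g r).hom.hom.hom) ≫ baseChangeHom U r) ≫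
      (((𝒞.baseChange z'').baseChangeCompGrpIso g r).inv.hom.hom ≫ (𝒞.baseChangeCompGrpIso z'' (r ≫ g)).inv.hom.hom) with hΦ
  -- (η) the generic fibre of `τ_𝒜 ≫ U_{V_r}` (★ (ν8R) computation, verbatim) and of `τ_𝒞`, `σ_𝒞` (§1 coherence for `𝒞` at `z″`)
  have hbc : fibreHom (baseChangeHom U r) ηr = (((𝒜.baseChange z).baseChange g).fibreBaseChangeIso r ηr).hom ≫ fibreHom U (ηr ≫ r) ≫ (((𝒞.baseChange z'').baseChange g).fibreBaseChangeIso r ηr).inv := by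
    rw [← Category.assoc, Iso.eq_comp_inv]
    exact fibreHom_baseChangeHom_comp_fibreBaseChangeIso_hom r ηr U
  have hAV : fibreHom (((𝒜.baseChangeCompGrpIso z (r ≫ g)).hom.hom.hom ≫ ((𝒜.baseChange z).baseChangeCompGrpIso g r).hom.hom.hom) ≫ baseChangeHom U r) ηr =
      (𝒜.fibreBaseChangeIso j y ≪≫ 𝒜.fibreCongrPtIso hpr ≪≫ (𝒜.fibreBaseChangeIso ((r ≫ g) ≫ z) ηr).symm).inv ≫ homOfIsMonHom u ≫
        (𝒞.fibreBaseChangeIso j y'' ≪≫ 𝒞.fibreCongrPtIso hpt'' ≪≫ (𝒞.fibreBaseChangeIso z'' a).symm ≪≫ ((𝒞.baseChange z'').fibreCongrPtIso e).symm ≪≫ ((𝒞.baseChange z'').fibreBaseChangeIso g (ηr ≫ r)).symm).hom ≫ (((𝒞.baseChange z'').baseChange g).fibreBaseChangeIso r ηr).inv := by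
    rw [fibreHom_comp, hbc, hfib, ← fibreHom_comp_five_inv_eq_three_inv j z g r y a ηr hpt e hpr 𝒜]
    simp only [Category.assoc]
  have hCV : fibreHom ((𝒞.baseChangeCompGrpIso z'' (r ≫ g)).hom.hom.hom ≫ ((𝒞.baseChange z'').baseChangeCompGrpIso g r).hom.hom.hom) ηr =
      (𝒞.fibreBaseChangeIso j y'' ≪≫ 𝒞.fibreCongrPtIso hpr'' ≪≫ (𝒞.fibreBaseChangeIso ((r ≫ g) ≫ z'') ηr).symm).inv ≫
        (𝒞.fibreBaseChangeIso j y'' ≪≫ 𝒞.fibreCongrPtIso hpt'' ≪≫ (𝒞.fibreBaseChangeIso z'' a).symm ≪≫ ((𝒞.baseChange z'').fibreCongrPtIso e).symm ≪≫ ((𝒞.baseChange z'').fibreBaseChangeIso g (ηr ≫ r)).symm).hom ≫ (((𝒞.baseChange z'').baseChange g).fibreBaseChangeIso r ηr).inv := by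
    rw [← fibreHom_comp_five_inv_eq_three_inv j z'' g r y'' a ηr hpt'' e hpr'' 𝒞]
    simp only [Category.assoc, Iso.inv_hom_id_assoc, Iso.hom_inv_id, Category.comp_id]
  -- on underlying morphisms over `Spec Ω`
  have e1 : (Over.pullback ηr).map (((𝒜.baseChangeCompGrpIso z (r ≫ g)).hom.hom.hom ≫ ((𝒜.baseChange z).baseChangeCompGrpIso g r).hom.hom.hom) ≫ baseChangeHom U r) =
      (𝒜.fibreBaseChangeIso j y ≪≫ 𝒜.fibreCongrPtIso hpr ≪≫ (𝒜.fibreBaseChangeIso ((r ≫ g) ≫ z) ηr).symm).inv.hom.hom.hom ≫ u ≫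
        ((𝒞.fibreBaseChangeIso j y'' ≪≫ 𝒞.fibreCongrPtIso hpt'' ≪≫ (𝒞.fibreBaseChangeIso z'' a).symm ≪≫ ((𝒞.baseChange z'').fibreCongrPtIso e).symm ≪≫ ((𝒞.baseChange z'').fibreBaseChangeIso g (ηr ≫ r)).symm) ≪≫ (((𝒞.baseChange z'').baseChange g).fibreBaseChangeIso r ηr).symm).hom.hom.hom.hom := by
    change (fibreHom (((𝒜.baseChangeCompGrpIso z (r ≫ g)).hom.hom.hom ≫ ((𝒜.baseChange z).baseChangeCompGrpIso g r).hom.hom.hom) ≫ baseChangeHom U r) ηr).hom.hom.hom = _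
    rw [hAV]
    rfl
  have eC : (Over.pullback ηr).map ((𝒞.baseChangeCompGrpIso z'' (r ≫ g)).hom.hom.hom ≫ ((𝒞.baseChange z'').baseChangeCompGrpIso g r).hom.hom.hom) =
      (𝒞.fibreBaseChangeIso j y'' ≪≫ 𝒞.fibreCongrPtIso hpr'' ≪≫ (𝒞.fibreBaseChangeIso ((r ≫ g) ≫ z'') ηr).symm).inv.hom.hom.hom ≫
        ((𝒞.fibreBaseChangeIso j y'' ≪≫ 𝒞.fibreCongrPtIso hpt'' ≪≫ (𝒞.fibreBaseChangeIso z'' a).symm ≪≫ ((𝒞.baseChange z'').fibreCongrPtIso e).symm ≪≫ ((𝒞.baseChange z'').fibreBaseChangeIso g (ηr ≫ r)).symm) ≪≫ (((𝒞.baseChange z'').baseChange g).fibreBaseChangeIso r ηr).symm).hom.hom.hom.hom := by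
    change (fibreHom ((𝒞.baseChangeCompGrpIso z'' (r ≫ g)).hom.hom.hom ≫ ((𝒞.baseChange z'').baseChangeCompGrpIso g r).hom.hom.hom) ηr).hom.hom.hom = _
    rw [hCV]
    rfl
  -- the generic fibre of `σ_𝒞` is the inverse
  have eσ : (Over.pullback ηr).map (((𝒞.baseChange z'').baseChangeCompGrpIso g r).inv.hom.hom ≫ (𝒞.baseChangeCompGrpIso z'' (r ≫ g)).inv.hom.hom) =
      ((𝒞.fibreBaseChangeIso j y'' ≪≫ 𝒞.fibreCongrPtIso hpt'' ≪≫ (𝒞.fibreBaseChangeIso z'' a).symm ≪≫ ((𝒞.baseChange z'').fibreCongrPtIso e).symm ≪≫ ((𝒞.baseChange z'').fibreBaseChangeIso g (ηr ≫ r)).symm) ≪≫ (((𝒞.baseChange z'').baseChange g).fibreBaseChangeIso r ηr).symm).inv.hom.hom.hom ≫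
        (𝒞.fibreBaseChangeIso j y'' ≪≫ 𝒞.fibreCongrPtIso hpr'' ≪≫ (𝒞.fibreBaseChangeIso ((r ≫ g) ≫ z'') ηr).symm).hom.hom.hom.hom := by
    have hτR : (Over.pullback ηr).map ((𝒞.baseChangeCompGrpIso z'' (r ≫ g)).hom.hom.hom ≫ ((𝒞.baseChange z'').baseChangeCompGrpIso g r).hom.hom.hom) ≫
        (((𝒞.fibreBaseChangeIso j y'' ≪≫ 𝒞.fibreCongrPtIso hpt'' ≪≫ (𝒞.fibreBaseChangeIso z'' a).symm ≪≫ ((𝒞.baseChange z'').fibreCongrPtIso e).symm ≪≫ ((𝒞.baseChange z'').fibreBaseChangeIso g (ηr ≫ r)).symm) ≪≫ (((𝒞.baseChange z'').baseChange g).fibreBaseChangeIso r ηr).symm).inv.hom.hom.hom ≫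
          (𝒞.fibreBaseChangeIso j y'' ≪≫ 𝒞.fibreCongrPtIso hpr'' ≪≫ (𝒞.fibreBaseChangeIso ((r ≫ g) ≫ z'') ηr).symm).hom.hom.hom.hom) = 𝟙 _ := by
      rw [eC]
      simp only [Category.assoc, reassoc_of% (AbelianVariety.iso_hom_hom_hom_hom_comp_inv
        ((𝒞.fibreBaseChangeIso j y'' ≪≫ 𝒞.fibreCongrPtIso hpt'' ≪≫ (𝒞.fibreBaseChangeIso z'' a).symm ≪≫ ((𝒞.baseChange z'').fibreCongrPtIso e).symm ≪≫ ((𝒞.baseChange z'').fibreBaseChangeIso g (ηr ≫ r)).symm) ≪≫ (((𝒞.baseChange z'').baseChange g).fibreBaseChangeIso r ηr).symm)), avIso_inv_comp_hom]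
      rfl
    have hστ' : (Over.pullback ηr).map (((𝒞.baseChange z'').baseChangeCompGrpIso g r).inv.hom.hom ≫ (𝒞.baseChangeCompGrpIso z'' (r ≫ g)).inv.hom.hom) ≫
        (Over.pullback ηr).map ((𝒞.baseChangeCompGrpIso z'' (r ≫ g)).hom.hom.hom ≫ ((𝒞.baseChange z'').baseChangeCompGrpIso g r).hom.hom.hom) = 𝟙 _ := by
      rw [← Functor.map_comp, hστ, CategoryTheory.Functor.map_id]
    calc (Over.pullback ηr).map (((𝒞.baseChange z'').baseChangeCompGrpIso g r).inv.hom.hom ≫ (𝒞.baseChangeCompGrpIso z'' (r ≫ g)).inv.hom.hom)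
        = (Over.pullback ηr).map (((𝒞.baseChange z'').baseChangeCompGrpIso g r).inv.hom.hom ≫ (𝒞.baseChangeCompGrpIso z'' (r ≫ g)).inv.hom.hom) ≫
            ((Over.pullback ηr).map ((𝒞.baseChangeCompGrpIso z'' (r ≫ g)).hom.hom.hom ≫ ((𝒞.baseChange z'').baseChangeCompGrpIso g r).hom.hom.hom) ≫
              (((𝒞.fibreBaseChangeIso j y'' ≪≫ 𝒞.fibreCongrPtIso hpt'' ≪≫ (𝒞.fibreBaseChangeIso z'' a).symm ≪≫ ((𝒞.baseChange z'').fibreCongrPtIso e).symm ≪≫ ((𝒞.baseChange z'').fibreBaseChangeIso g (ηr ≫ r)).symm) ≪≫ (((𝒞.baseChange z'').baseChange g).fibreBaseChangeIso r ηr).symm).inv.hom.hom.hom ≫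
                (𝒞.fibreBaseChangeIso j y'' ≪≫ 𝒞.fibreCongrPtIso hpr'' ≪≫ (𝒞.fibreBaseChangeIso ((r ≫ g) ≫ z'') ηr).symm).hom.hom.hom.hom)) := by rw [hτR, Category.comp_id]
      _ = _ := by rw [← Category.assoc, hστ', Category.id_comp]
  -- the generic fibre of `incl ≫ Φ` factors through `ζ`
  have hfac' : ∃ m : (Over.pullback ηr).obj 𝒦 ⟶ (Over.pullback ηr).obj 𝒵, m ≫ (Over.pullback ηr).map ζ = (Over.pullback ηr).map (incl ≫ Φ) := by
    obtain ⟨m, hm⟩ := hfac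
    refine ⟨m, ?_⟩
    have hm' := congrArg (fun φ => φ ≫ (𝒞.fibreBaseChangeIso j y'' ≪≫ 𝒞.fibreCongrPtIso hpr'' ≪≫ (𝒞.fibreBaseChangeIso ((r ≫ g) ≫ z'') ηr).symm).hom.hom.hom.hom) hm
    simp only [Category.assoc, avIso_inv_comp_hom] at hm'
    erw [Category.comp_id] at hm'
    rw [hm', hΦ, Functor.map_comp, Functor.map_comp, e1, eσ]
    simp only [Category.assoc, reassoc_of% (AbelianVariety.iso_hom_hom_hom_hom_comp_inv
      ((𝒞.fibreBaseChangeIso j y'' ≪≫ 𝒞.fibreCongrPtIso hpt'' ≪≫ (𝒞.fibreBaseChangeIso z'' a).symm ≪≫ ((𝒞.baseChange z'').fibreCongrPtIso e).symm ≪≫ ((𝒞.baseChange z'').fibreBaseChangeIso g (ηr ≫ r)).symm) ≪≫ (((𝒞.baseChange z'').baseChange g).fibreBaseChangeIso r ηr).symm))]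
  -- ★ (a): the factorisation over `V_r`
  obtain ⟨M, hM⟩ := exists_comp_eq_of_pullback_map ηr (incl ≫ Φ) ζ hfac'
  -- (s) the special fibre of `τ_𝒜 ≫ U_{V_r}` (★ (ν8R) computation, verbatim) and of `σ_𝒞`
  have hbcs : fibreHom (baseChangeHom U r) sr = (((𝒜.baseChange z).baseChange g).fibreBaseChangeIso r sr).hom ≫ fibreHom U (sr ≫ r) ≫ (((𝒞.baseChange z'').baseChange g).fibreBaseChangeIso r sr).inv := by
    rw [← Category.assoc, Iso.eq_comp_inv]
    exact fibreHom_baseChangeHom_comp_fibreBaseChangeIso_hom r sr U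
  have hAVs : fibreHom (((𝒜.baseChangeCompGrpIso z (r ≫ g)).hom.hom.hom ≫ ((𝒜.baseChange z).baseChangeCompGrpIso g r).hom.hom.hom) ≫ baseChangeHom U r) sr =
      (𝒜.fibreBaseChangeIso js ys ≪≫ 𝒜.fibreCongrPtIso hps ≪≫ (𝒜.fibreBaseChangeIso ((r ≫ g) ≫ z) sr).symm).inv ≫
        ((𝒜.fibreBaseChangeIso js ys ≪≫ 𝒜.fibreCongrPtIso hspt ≪≫ (𝒜.fibreBaseChangeIso z b).symm ≪≫ ((𝒜.baseChange z).fibreCongrPtIso es).symm ≪≫ ((𝒜.baseChange z).fibreBaseChangeIso g (sr ≫ r)).symm).hom ≫ fibreHom U (sr ≫ r) ≫ (𝒞.fibreBaseChangeIso js ys'' ≪≫ 𝒞.fibreCongrPtIso hspt'' ≪≫ (𝒞.fibreBaseChangeIso z'' b).symm ≪≫ ((𝒞.baseChange z'').fibreCongrPtIso es).symm ≪≫ ((𝒞.baseChange z'').fibreBaseChangeIso g (sr ≫ r)).symm).inv) ≫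
        (𝒞.fibreBaseChangeIso js ys'' ≪≫ 𝒞.fibreCongrPtIso hspt'' ≪≫ (𝒞.fibreBaseChangeIso z'' b).symm ≪≫ ((𝒞.baseChange z'').fibreCongrPtIso es).symm ≪≫ ((𝒞.baseChange z'').fibreBaseChangeIso g (sr ≫ r)).symm).hom ≫ (((𝒞.baseChange z'').baseChange g).fibreBaseChangeIso r sr).inv := by
    rw [fibreHom_comp, hbcs, ← fibreHom_comp_five_inv_eq_three_inv js z g r ys b sr hspt es hps 𝒜]
    simp only [Category.assoc, Iso.inv_hom_id_assoc]
  have hCVs : fibreHom ((𝒞.baseChangeCompGrpIso z'' (r ≫ g)).hom.hom.hom ≫ ((𝒞.baseChange z'').baseChangeCompGrpIso g r).hom.hom.hom) sr =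
      (𝒞.fibreBaseChangeIso js ys'' ≪≫ 𝒞.fibreCongrPtIso hps'' ≪≫ (𝒞.fibreBaseChangeIso ((r ≫ g) ≫ z'') sr).symm).inv ≫
        (𝒞.fibreBaseChangeIso js ys'' ≪≫ 𝒞.fibreCongrPtIso hspt'' ≪≫ (𝒞.fibreBaseChangeIso z'' b).symm ≪≫ ((𝒞.baseChange z'').fibreCongrPtIso es).symm ≪≫ ((𝒞.baseChange z'').fibreBaseChangeIso g (sr ≫ r)).symm).hom ≫ (((𝒞.baseChange z'').baseChange g).fibreBaseChangeIso r sr).inv := by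
    rw [← fibreHom_comp_five_inv_eq_three_inv js z'' g r ys'' b sr hspt'' es hps'' 𝒞]
    simp only [Category.assoc, Iso.inv_hom_id_assoc, Iso.hom_inv_id, Category.comp_id]
  have e2 : (Over.pullback sr).map (((𝒜.baseChangeCompGrpIso z (r ≫ g)).hom.hom.hom ≫ ((𝒜.baseChange z).baseChangeCompGrpIso g r).hom.hom.hom) ≫ baseChangeHom U r) =
      (𝒜.fibreBaseChangeIso js ys ≪≫ 𝒜.fibreCongrPtIso hps ≪≫ (𝒜.fibreBaseChangeIso ((r ≫ g) ≫ z) sr).symm).inv.hom.hom.hom ≫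
        ((𝒜.fibreBaseChangeIso js ys ≪≫ 𝒜.fibreCongrPtIso hspt ≪≫ (𝒜.fibreBaseChangeIso z b).symm ≪≫ ((𝒜.baseChange z).fibreCongrPtIso es).symm ≪≫ ((𝒜.baseChange z).fibreBaseChangeIso g (sr ≫ r)).symm).hom ≫ fibreHom U (sr ≫ r) ≫ (𝒞.fibreBaseChangeIso js ys'' ≪≫ 𝒞.fibreCongrPtIso hspt'' ≪≫ (𝒞.fibreBaseChangeIso z'' b).symm ≪≫ ((𝒞.baseChange z'').fibreCongrPtIso es).symm ≪≫ ((𝒞.baseChange z'').fibreBaseChangeIso g (sr ≫ r)).symm).inv).hom.hom.hom ≫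
        ((𝒞.fibreBaseChangeIso js ys'' ≪≫ 𝒞.fibreCongrPtIso hspt'' ≪≫ (𝒞.fibreBaseChangeIso z'' b).symm ≪≫ ((𝒞.baseChange z'').fibreCongrPtIso es).symm ≪≫ ((𝒞.baseChange z'').fibreBaseChangeIso g (sr ≫ r)).symm) ≪≫ (((𝒞.baseChange z'').baseChange g).fibreBaseChangeIso r sr).symm).hom.hom.hom.hom := by
    change (fibreHom (((𝒜.baseChangeCompGrpIso z (r ≫ g)).hom.hom.hom ≫ ((𝒜.baseChange z).baseChangeCompGrpIso g r).hom.hom.hom) ≫ baseChangeHom U r) sr).hom.hom.hom = _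
    rw [hAVs]
    rfl
  have eCs : (Over.pullback sr).map ((𝒞.baseChangeCompGrpIso z'' (r ≫ g)).hom.hom.hom ≫ ((𝒞.baseChange z'').baseChangeCompGrpIso g r).hom.hom.hom) =
      (𝒞.fibreBaseChangeIso js ys'' ≪≫ 𝒞.fibreCongrPtIso hps'' ≪≫ (𝒞.fibreBaseChangeIso ((r ≫ g) ≫ z'') sr).symm).inv.hom.hom.hom ≫
        ((𝒞.fibreBaseChangeIso js ys'' ≪≫ 𝒞.fibreCongrPtIso hspt'' ≪≫ (𝒞.fibreBaseChangeIso z'' b).symm ≪≫ ((𝒞.baseChange z'').fibreCongrPtIso es).symm ≪≫ ((𝒞.baseChange z'').fibreBaseChangeIso g (sr ≫ r)).symm) ≪≫ (((𝒞.baseChange z'').baseChange g).fibreBaseChangeIso r sr).symm).hom.hom.hom.hom := by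
    change (fibreHom ((𝒞.baseChangeCompGrpIso z'' (r ≫ g)).hom.hom.hom ≫ ((𝒞.baseChange z'').baseChangeCompGrpIso g r).hom.hom.hom) sr).hom.hom.hom = _
    rw [hCVs]
    rfl
  have eσs : (Over.pullback sr).map (((𝒞.baseChange z'').baseChangeCompGrpIso g r).inv.hom.hom ≫ (𝒞.baseChangeCompGrpIso z'' (r ≫ g)).inv.hom.hom) =
      ((𝒞.fibreBaseChangeIso js ys'' ≪≫ 𝒞.fibreCongrPtIso hspt'' ≪≫ (𝒞.fibreBaseChangeIso z'' b).symm ≪≫ ((𝒞.baseChange z'').fibreCongrPtIso es).symm ≪≫ ((𝒞.baseChange z'').fibreBaseChangeIso g (sr ≫ r)).symm) ≪≫ (((𝒞.baseChange z'').baseChange g).fibreBaseChangeIso r sr).symm).inv.hom.hom.hom ≫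
        (𝒞.fibreBaseChangeIso js ys'' ≪≫ 𝒞.fibreCongrPtIso hps'' ≪≫ (𝒞.fibreBaseChangeIso ((r ≫ g) ≫ z'') sr).symm).hom.hom.hom.hom := by
    have hτR : (Over.pullback sr).map ((𝒞.baseChangeCompGrpIso z'' (r ≫ g)).hom.hom.hom ≫ ((𝒞.baseChange z'').baseChangeCompGrpIso g r).hom.hom.hom) ≫
        (((𝒞.fibreBaseChangeIso js ys'' ≪≫ 𝒞.fibreCongrPtIso hspt'' ≪≫ (𝒞.fibreBaseChangeIso z'' b).symm ≪≫ ((𝒞.baseChange z'').fibreCongrPtIso es).symm ≪≫ ((𝒞.baseChange z'').fibreBaseChangeIso g (sr ≫ r)).symm) ≪≫ (((𝒞.baseChange z'').baseChange g).fibreBaseChangeIso r sr).symm).inv.hom.hom.hom ≫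
          (𝒞.fibreBaseChangeIso js ys'' ≪≫ 𝒞.fibreCongrPtIso hps'' ≪≫ (𝒞.fibreBaseChangeIso ((r ≫ g) ≫ z'') sr).symm).hom.hom.hom.hom) = 𝟙 _ := by
      rw [eCs]
      simp only [Category.assoc, reassoc_of% (AbelianVariety.iso_hom_hom_hom_hom_comp_inv
        ((𝒞.fibreBaseChangeIso js ys'' ≪≫ 𝒞.fibreCongrPtIso hspt'' ≪≫ (𝒞.fibreBaseChangeIso z'' b).symm ≪≫ ((𝒞.baseChange z'').fibreCongrPtIso es).symm ≪≫ ((𝒞.baseChange z'').fibreBaseChangeIso g (sr ≫ r)).symm) ≪≫ (((𝒞.baseChange z'').baseChange g).fibreBaseChangeIso r sr).symm)), avIso_inv_comp_hom]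
      rfl
    have hστ' : (Over.pullback sr).map (((𝒞.baseChange z'').baseChangeCompGrpIso g r).inv.hom.hom ≫ (𝒞.baseChangeCompGrpIso z'' (r ≫ g)).inv.hom.hom) ≫
        (Over.pullback sr).map ((𝒞.baseChangeCompGrpIso z'' (r ≫ g)).hom.hom.hom ≫ ((𝒞.baseChange z'').baseChangeCompGrpIso g r).hom.hom.hom) = 𝟙 _ := by
      rw [← Functor.map_comp, hστ, CategoryTheory.Functor.map_id]
    calc (Over.pullback sr).map (((𝒞.baseChange z'').baseChangeCompGrpIso g r).inv.hom.hom ≫ (𝒞.baseChangeCompGrpIso z'' (r ≫ g)).inv.hom.hom)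
        = (Over.pullback sr).map (((𝒞.baseChange z'').baseChangeCompGrpIso g r).inv.hom.hom ≫ (𝒞.baseChangeCompGrpIso z'' (r ≫ g)).inv.hom.hom) ≫
            ((Over.pullback sr).map ((𝒞.baseChangeCompGrpIso z'' (r ≫ g)).hom.hom.hom ≫ ((𝒞.baseChange z'').baseChangeCompGrpIso g r).hom.hom.hom) ≫
              (((𝒞.fibreBaseChangeIso js ys'' ≪≫ 𝒞.fibreCongrPtIso hspt'' ≪≫ (𝒞.fibreBaseChangeIso z'' b).symm ≪≫ ((𝒞.baseChange z'').fibreCongrPtIso es).symm ≪≫ ((𝒞.baseChange z'').fibreBaseChangeIso g (sr ≫ r)).symm) ≪≫ (((𝒞.baseChange z'').baseChange g).fibreBaseChangeIso r sr).symm).inv.hom.hom.hom ≫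
                (𝒞.fibreBaseChangeIso js ys'' ≪≫ 𝒞.fibreCongrPtIso hps'' ≪≫ (𝒞.fibreBaseChangeIso ((r ≫ g) ≫ z'') sr).symm).hom.hom.hom.hom)) := by rw [hτR, Category.comp_id]
      _ = _ := by rw [← Category.assoc, hστ', Category.id_comp]
  -- base change of the factorisation to `s_r`, read back through the special three-piece isomorphisms
  refine ⟨(Over.pullback sr).map M, ?_⟩
  have hMs : (Over.pullback sr).map M ≫ (Over.pullback sr).map ζ = (Over.pullback sr).map incl ≫ (Over.pullback sr).map Φ := by
    rw [← Functor.map_comp, hM, Functor.map_comp]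
  have hΦs : (Over.pullback sr).map Φ =
      (𝒜.fibreBaseChangeIso js ys ≪≫ 𝒜.fibreCongrPtIso hps ≪≫ (𝒜.fibreBaseChangeIso ((r ≫ g) ≫ z) sr).symm).inv.hom.hom.hom ≫
        ((𝒜.fibreBaseChangeIso js ys ≪≫ 𝒜.fibreCongrPtIso hspt ≪≫ (𝒜.fibreBaseChangeIso z b).symm ≪≫ ((𝒜.baseChange z).fibreCongrPtIso es).symm ≪≫ ((𝒜.baseChange z).fibreBaseChangeIso g (sr ≫ r)).symm).hom ≫ fibreHom U (sr ≫ r) ≫ (𝒞.fibreBaseChangeIso js ys'' ≪≫ 𝒞.fibreCongrPtIso hspt'' ≪≫ (𝒞.fibreBaseChangeIso z'' b).symm ≪≫ ((𝒞.baseChange z'').fibreCongrPtIso es).symm ≪≫ ((𝒞.baseChange z'').fibreBaseChangeIso g (sr ≫ r)).symm).inv).hom.hom.hom ≫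
        (𝒞.fibreBaseChangeIso js ys'' ≪≫ 𝒞.fibreCongrPtIso hps'' ≪≫ (𝒞.fibreBaseChangeIso ((r ≫ g) ≫ z'') sr).symm).hom.hom.hom.hom := by
    rw [hΦ, Functor.map_comp, e2, eσs]
    simp only [Category.assoc, reassoc_of% (AbelianVariety.iso_hom_hom_hom_hom_comp_inv
      ((𝒞.fibreBaseChangeIso js ys'' ≪≫ 𝒞.fibreCongrPtIso hspt'' ≪≫ (𝒞.fibreBaseChangeIso z'' b).symm ≪≫ ((𝒞.baseChange z'').fibreCongrPtIso es).symm ≪≫ ((𝒞.baseChange z'').fibreBaseChangeIso g (sr ≫ r)).symm) ≪≫ (((𝒞.baseChange z'').baseChange g).fibreBaseChangeIso r sr).symm))]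
  have key := congrArg (fun φ => φ ≫ (𝒞.fibreBaseChangeIso js ys'' ≪≫ 𝒞.fibreCongrPtIso hps'' ≪≫ (𝒞.fibreBaseChangeIso ((r ≫ g) ≫ z'') sr).symm).inv.hom.hom.hom) hMs
  simp only [Category.assoc] at key
  rw [hΦs] at key
  simp only [Category.assoc, AbelianVariety.iso_hom_hom_hom_hom_comp_inv, Category.comp_id] at key
  simpa only [Category.assoc] using key

end Model

end AbelianSchemeOver

end Literature.AlgebraicGeometry.AbelianSchemes

end
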